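import Mathlib.Data.ZMod.Basic
import Mathlib.GroupTheory.SpecificGroups.Cyclic
import Summits.MatrixMultiplication.OmegaCensus.BoxBadSmallGroups2

/-!
# ω-census, family (b3): metacyclic groups `ℤ/N ⋊_u ℤ/q` as a kernel-computable type (for box witnesses of Frobenius / metacyclic census rows)

HONEST FRAMING (pub-omega census; verbatim): lottery ticket; floor = certified bounds/negative ranges.
Census BOOKKEEPING (pub-omega stpp-1 gen 18): a computable model `MetaCyc N q u` of the split metacyclic group
`⟨a, b | a^N = 1, b^q = 1, b a b⁻¹ = a^u⟩` for a unit exponent `u` with `u^q ≡ 1 (mod N)` — elements `a^i b^t` as pairs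
`(i : ZMod N, t : ZMod q)` with `(i, t)(j, s) = (i + u^t j, t + s)` — whose group axioms are PROVED (not `decide`d), so that
order-`48…63` census rows (`F₅₅ = ℤ/11 ⋊₃ ℤ/5`, `F₅₇ = ℤ/19 ⋊₇ ℤ/3`, AG-48-28 `= ℤ/24 ⋊₅ ℤ/2`, the dihedral and Frobenius
families in general) get kernel box witnesses by `decide` on the witness alone.  Nothing here is progress on `ω`.
-/

namespace Summit.MatrixMultiplication.OmegaCensus

/-- The split metacyclic group `ℤ/N ⋊_u ℤ/q`: elements `a^i b^t` as exponent pairs; `b` acts on `⟨a⟩` by `a ↦ a^u`. [folklore] -/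
structure MetaCyc (N q : ℕ) (u : ZMod N) where
  /-- exponent of `a` -/
  i : ZMod N
  /-- exponent of `b` -/
  t : ZMod q
  deriving DecidableEq

namespace MetaCyc

variable {N q : ℕ} {u : ZMod N}

/-- Two elements agree iff both exponents agree. [folklore] -/
@[ext] theorem ext {x y : MetaCyc N q u} (hi : x.i = y.i) (ht : x.t = y.t) : x = y := by
  cases x; cases y; congr

/-- `u^t` for an exponent `t : ZMod q` (through `t.val`). [folklore] -/
def act (u : ZMod N) (t : ZMod q) : ZMod N := u ^ t.val

/-- `(a^i b^t)(a^j b^s) = a^{i + u^t j} b^{t+s}`. [folklore] -/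
instance : Mul (MetaCyc N q u) := ⟨fun x y => ⟨x.i + act u x.t * y.i, x.t + y.t⟩⟩

/-- Identity `a^0 b^0`. [folklore] -/
instance : One (MetaCyc N q u) := ⟨⟨0, 0⟩⟩

/-- Inverse `(a^i b^t)⁻¹ = a^{-u^{-t} i} b^{-t}`. [folklore] -/
instance : Inv (MetaCyc N q u) := ⟨fun x => ⟨-(act u (-x.t) * x.i), -x.t⟩⟩

/-- The multiplication rule, unfolded. [folklore] -/
theorem mul_def (x y : MetaCyc N q u) : x * y = ⟨x.i + act u x.t * y.i, x.t + y.t⟩ := rfl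
/-- The identity, unfolded. [folklore] -/
theorem one_def : (1 : MetaCyc N q u) = ⟨0, 0⟩ := rfl
/-- The inverse, unfolded. [folklore] -/
theorem inv_def (x : MetaCyc N q u) : x⁻¹ = ⟨-(act u (-x.t) * x.i), -x.t⟩ := rfl

/-- `u^q = 1` makes `t ↦ u^t` multiplicative on `ZMod q`. [folklore] -/
theorem act_add [NeZero q] (hu : u ^ q = 1) (s t : ZMod q) : act u (s + t) = act u s * act u t := by
  unfold act
  rw [ZMod.val_add, ← pow_add]
  conv_rhs => rw [← Nat.mod_add_div (s.val + t.val) q, pow_add, pow_mul, hu, one_pow, mul_one]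

/-- `u^0 = 1`. [folklore] -/
theorem act_zero : act u (0 : ZMod q) = 1 := by
  unfold act; rw [ZMod.val_zero, pow_zero]

/-- `MetaCyc N q u` is a group when `u^q = 1`. [folklore] -/
instance instGroup [NeZero q] [Fact (u ^ q = 1)] : Group (MetaCyc N q u) :=
  Group.ofLeftAxioms
    (fun x y z => by
      apply ext
      · simp only [mul_def, act_add Fact.out]; ring
      · simp only [mul_def]; ring)
    (fun x => by
      apply ext
      · simp only [mul_def, one_def, act_zero]; ring
      · simp only [mul_def, one_def]; ring)
    (fun x => by
      apply ext
      · simp only [mul_def, inv_def, one_def]; ring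
      · simp only [mul_def, inv_def, one_def]; ring)

/-- `MetaCyc N q u ≃ ZMod N × ZMod q` (as types). [folklore] -/
def equivProd : MetaCyc N q u ≃ ZMod N × ZMod q :=
  ⟨fun x => (x.i, x.t), fun p => ⟨p.1, p.2⟩, fun _ => rfl, fun _ => rfl⟩

/-- Finite, through `equivProd`. [folklore] -/
instance [NeZero N] [NeZero q] : Fintype (MetaCyc N q u) := Fintype.ofEquiv _ equivProd.symm

/-- `|ℤ/N ⋊ ℤ/q| = N q`. [folklore] -/
theorem card [NeZero N] [NeZero q] : Fintype.card (MetaCyc N q u) = N * q := by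
  rw [Fintype.ofEquiv_card, Fintype.card_prod, ZMod.card, ZMod.card]

end MetaCyc

end Summit.MatrixMultiplication.OmegaCensus
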